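import Literature.AlgebraicGeometry.Motives.WeilJacobianUniversal
import Literature.AlgebraicGeometry.Motives.WeilJacobianStepOneOpen
import Literature.AlgebraicGeometry.RelativeSpec.GeometricQuotientEtaleOnFreeLocus
import HarnessLib

/-!
# Weil's Abel–Jacobi map is unramified: the chart `C → Cᵍ → C^{(g)} ⊇ W ↪ J` near a good tuple
# (Milne, *Jacobian Varieties*, §2 Prop. 2.3 via §5 Thm. 5.1 (a) and §7)

Layer `Literature/AlgebraicGeometry/Motives`, namespace `….Motives.WeilJacobian` (Weil's data `C, hC, hX, g, hg, hW,
j₀` of ★ `Motives/WeilJacobianGlue` … `WeilJacobianUniversal`, `K = K̄`, `char K = 0`).  THEOREMS ONLY (no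
definition, no named fact, no instance, sorry-free).

Milne, *Jacobian Varieties* §2, Prop. 2.3: «The map `f^P : C → J` is a closed immersion»; the printed proof of
the infinitesimal clause uses `Γ(C, Ω¹(−Q)) ⊊ Γ(C, Ω¹)`.  Here the infinitesimal clause is obtained WITHOUT
differential forms, from WEIL'S CHART: for an injective tuple `τ'` of `K`-points with `ℓ(Σⱼ[τ'ⱼ]) = 1`, near
`Q = τ'_{j₀}` the translate `t_c ∘ f` (`c = ∏_{j≠j₀} f(τ'ⱼ)`) is the composite

  `C ─s_{τ'}→ Cᵍ ─mk→ C^{(g)} ⊇ W ─f^{(g)}→ J`,   `s_{τ'}(x) = (τ'₀, …, x, …, τ'_{g−1})`,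

with `s_{τ'}` a section of `pr_{j₀}` (closed immersion), `mk` ÉTALE off the big diagonal (★
`RelativeSpec/GeometricQuotientEtaleOnFreeLocus`, SGA 1 V Prop. 2.6), `W = {ℓ = 1}` Weil's chart and `f^{(g)}|_W`
an OPEN IMMERSION (★ `WeilJacobian.isOpenImmersion_chartWOpens_ι_comp`, Milne Thm. 5.1 (a)).  Hence `f` is
FORMALLY UNRAMIFIED near `Q`.  (The sequel ★-pending `Motives/JacobianAbelJacobiClosedImmersion` covers `C` by
such neighbourhoods and concludes Prop. 2.3 with «finite + unramified + injective ⇒ closed immersion».)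

* §1 `comp_liftOver_update`, `liftOver_update_coord`, **`liftOver_comp_prod_coord_fJ`** — the tuple section
  `s_{τ'}` and `Σf ∘ s_{τ'} = t_c ∘ f` (K-points separate morphisms, ★ `SchemeOver.hom_ext_of_forall_algPoints`).
* §2 **`exists_stable_opens_injective`** — the general locus OFF THE BIG DIAGONAL: an `𝔖_g`-stable open
  `U ⊆ Cᵍ` over `W` whose geometric points have pairwise distinct coordinates, containing `(τ'ⱼ)` (the
  diagonal maps `δ_{ij}` are proper with closed images; ★ `apply_eq_of_pt_mem_range_diagMap`, ★
  `pt_mem_generalLocus_iff`, ★ `preimage_chartW`; cf. ★ `exists_opens_general_sum`, Milne Lemma 6.7).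
* §3 **`exists_opens_formallyUnramified_fJ`** — Weil's `f` is formally unramified on a neighbourhood of `τ'_{j₀}`
  (Mathlib `FormallyUnramified.of_comp`, `IsClosedImmersion.of_comp`, `[Mono f] → IsIso (diagonal f)`).

Cell `hodgecm-mathlib` (D-0151), count-neutral capital (census `A-provers/A-p12/g11/CENSUS-MilneProp23-TangentClause.A-p12g11.md`).
HC_CM is proved only modulo the 7 printed citations until rung 0 closes; this file discharges none of them.

## References

* J. S. Milne, *Jacobian Varieties*, in G. Cornell, J. H. Silverman (eds.), *Arithmetic Geometry* (Storrs 1984),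
  Springer 1986, Ch. VII: §2 Prop. 2.3, §5 Thm. 5.1 (a), §6 Lemma 6.7, §7 Thm. 7.1. [Milne1986JacobianVarieties]
* A. Grothendieck, *SGA 1*, Exp. V Prop. 2.6. [SGA1]
-/

set_option autoImplicit false

noncomputable section

universe u

open CategoryTheory CategoryTheory.Limits AlgebraicGeometry MonoidalCategory CartesianMonoidalCategory MonObj
  TopologicalSpace
open Literature.NumberTheory.DiophantineGeometry
open Literature.NumberTheory.DiophantineGeometry.AlgFunctionField
open Literature.AlgebraicGeometry.RelativeSpec

namespace Literature.AlgebraicGeometry.Motives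

open RatFn FieldPoint CartierDivisor CurvePlaces

namespace WeilJacobian

variable {K : Type u} [Field K] [IsAlgClosed K] [CharZero K]
  (C : SchemeOver K) [IsIntegral C.left] [SmoothOfRelativeDimension 1 C.hom] [IsProper C.hom]
  [GeometricallyIntegral C.hom] (hC : IsProjectiveOver C) (hX : CechPseudoCoherentAt C) (g : ℕ)
  (hg : (genus K (curveBC C (strPt (K := K) K)).left.functionField : ℤ) ≤ g)
  (hW : (chartW C g hC).Nonempty) (j₀ : Fin g)

/-! ## §1 The section `x ↦ (τ'₀, …, x, …, τ'_{g−1})` and `Σf ∘ s_{τ'} = t_c ∘ f` -/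

omit [IsAlgClosed K] [CharZero K] [IsIntegral C.left] [SmoothOfRelativeDimension 1 C.hom] [IsProper C.hom]
  [GeometricallyIntegral C.hom] in
/-- The tuple section on `K`-points: `x ↦ (τ' with x in position j₀)` (Milne's `f^r` precomposed with a section).
[cite: Milne1986JacobianVarieties, §5 (the maps f^r : C^r → J)] -/
theorem comp_liftOver_update (τ' : Fin g → AlgPoints C K) (x : AlgPoints C K) :
    x ≫ liftOver C.hom g (fun j => if j = j₀ then 𝟙 C else const C C (τ' j)) =
      tuplePt C (strPt (K := K) K) (Function.update τ' j₀ x) := by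
  rw [← tuplePt_comp_coord C g _ (x ≫ liftOver C.hom g (fun j => if j = j₀ then 𝟙 C else const C C (τ' j)))]
  congr 1
  funext j
  rw [Category.assoc, show liftOver C.hom g _ ≫ coord C g j = _ from liftOver_projOver C.hom g _ j]
  by_cases h : j = j₀
  · subst h
    rw [if_pos rfl, Category.comp_id, Function.update_self]
  · rw [if_neg h, comp_const, Function.update_of_ne h]

omit [IsAlgClosed K] [CharZero K] [IsIntegral C.left] [SmoothOfRelativeDimension 1 C.hom] [IsProper C.hom]
  [GeometricallyIntegral C.hom] in
/-- The tuple section is a section of the `j₀`-th projection. [cite: Milne1986JacobianVarieties, §5 (the maps f^r : C^r → J)] -/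
theorem liftOver_update_coord (τ' : Fin g → AlgPoints C K) :
    liftOver C.hom g (fun j => if j = j₀ then 𝟙 C else const C C (τ' j)) ≫ coord C g j₀ = 𝟙 C := by
  rw [show liftOver C.hom g _ ≫ coord C g j₀ = _ from liftOver_projOver C.hom g _ j₀, if_pos rfl]

/-- **`Σf ∘ s_{τ'} = t_c ∘ f`**: the tuple section followed by the Abel sum `Σf = ∏ⱼ prⱼ ≫ f` is `f` followed
by the translation by the constant `c = ∏_{j ≠ j₀} f(τ'ⱼ)` (both have value `f(x) · c` on a `K`-point `x`; ★
`SchemeOver.hom_ext_of_forall_algPoints`). [cite: Milne1986JacobianVarieties, §5 (the maps f^r : C^r → J) and §2] -/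
theorem liftOver_comp_prod_coord_fJ (τ' : Fin g → AlgPoints C K) :
    liftOver C.hom g (fun j => if j = j₀ then 𝟙 C else const C C (τ' j)) ≫
        (∏ j, coord C g j ≫ fJ C hC hX g hg hW j₀) =
      fJ C hC hX g hg hW j₀ ≫ (Jac C hC hX g hg hW).translation
        (∏ j ∈ ({j₀}ᶜ : Finset (Fin g)), τ' j ≫ fJ C hC hX g hg hW j₀) := by
  classical
  refine SchemeOver.hom_ext_of_forall_algPoints K fun x => ?_
  rw [← Category.assoc, comp_liftOver_update, tuplePt_comp_prod_coord_fJ, ← Category.assoc,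
    AbelianVariety.comp_translation, Fintype.prod_eq_mul_prod_compl j₀, Function.update_self, mul_comm]
  congr 1
  exact Finset.prod_congr rfl fun j hj =>
    congrArg (· ≫ fJ C hC hX g hg hW j₀)
      (Function.update_of_ne (fun h => (Finset.mem_compl.mp hj) (Finset.mem_singleton.mpr h)) _ _)

/-! ## §2 The general locus off the big diagonal: an `𝔖_g`-stable open of `Cᵍ` with free geometric points -/

omit [IsAlgClosed K] [CharZero K] [IsIntegral C.left] [SmoothOfRelativeDimension 1 C.hom] [IsProper C.hom]
  [GeometricallyIntegral C.hom] in
/-- The coordinates of the diagonal map `δ_{ij} : Cᵍ → Cᵍ` (replace the `j`-th coordinate by the `i`-th). [folklore] -/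
private theorem diagMap_coord' (i j l : Fin g) :
    liftOver C.hom g (fun l => coord C g (if l = j then i else l)) ≫ coord C g l = coord C g (if l = j then i else l) :=
  liftOver_projOver C.hom g _ l

omit [IsAlgClosed K] [CharZero K] [IsIntegral C.left] [SmoothOfRelativeDimension 1 C.hom] [IsProper C.hom]
  [GeometricallyIntegral C.hom] in
/-- `δ_{ij} ∘ σ⁻¹ = σ⁻¹ ∘ δ_{σi, σj}`: the diagonal maps are permuted among themselves by `𝔖_g`. [folklore] -/
private theorem diagMap_comp_permOver (i j : Fin g) (σ : Equiv.Perm (Fin g)) :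
    liftOver C.hom g (fun l => coord C g (if l = j then i else l)) ≫ permOver C.hom g σ =
      permOver C.hom g σ ≫ liftOver C.hom g (fun l => coord C g (if l = σ j then σ i else l)) := by
  refine hom_ext_projOver C.hom g _ _ fun l => ?_
  change (_ ≫ permOver C.hom g σ) ≫ coord C g l = (permOver C.hom g σ ≫ _) ≫ coord C g l
  rw [Category.assoc, Category.assoc, diagMap_coord',
    show permOver C.hom g σ ≫ coord C g l = coord C g (σ.symm l) from permOver_projOver C.hom g σ l, diagMap_coord',
    show permOver C.hom g σ ≫ coord C g (if l = σ j then σ i else l) = coord C g (σ.symm (if l = σ j then σ i else l)) from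
      permOver_projOver C.hom g σ _]
  by_cases hl : l = σ j
  · rw [if_pos hl, if_pos (by rw [hl, Equiv.symm_apply_apply]), Equiv.symm_apply_apply]
  · rw [if_neg hl, if_neg (fun h => hl (by rw [← h, Equiv.apply_symm_apply]))]

omit [IsAlgClosed K] [CharZero K] [IsIntegral C.left] [SmoothOfRelativeDimension 1 C.hom] [IsProper C.hom]
  [GeometricallyIntegral C.hom] in
/-- A `T`-valued point of `Cᵍ` (over `K`) with `τᵢ = τⱼ` is fixed by `δ_{ij}`, hence its points lie in the image
of `δ_{ij}`. [folklore] -/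
private theorem mem_range_diagMap_of_comp_coord_eq {T : SchemeOver K} (τ : T ⟶ powC C g) {i j : Fin g}
    (h : τ ≫ coord C g i = τ ≫ coord C g j) (t : T.left) :
    τ.left t ∈ Set.range (liftOver C.hom g (fun l => coord C g (if l = j then i else l))).left := by
  have hfix : τ ≫ liftOver C.hom g (fun l => coord C g (if l = j then i else l)) = τ := by
    refine hom_ext_projOver C.hom g _ _ fun l => ?_
    change (τ ≫ _) ≫ coord C g l = τ ≫ coord C g l
    rw [Category.assoc, diagMap_coord']
    by_cases hl : l = j
    · subst hl; rw [if_pos rfl, h]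
    · rw [if_neg hl]
  refine ⟨τ.left t, ?_⟩
  rw [← Scheme.Hom.comp_apply, ← Over.comp_left, hfix]

omit [CharZero K] in
include hX in
/-- **The general locus off the big diagonal.**  For an INJECTIVE tuple `τ'` of `K`-points with
`ℓ(Σⱼ[τ'ⱼ]) = 1` there is an open `U ⊆ Cᵍ` which is STABLE under `𝔖_g`, all of whose geometric points have
PAIRWISE DISTINCT coordinates, which lies over Weil's chart `W` (`U ⊆ mk⁻¹W` = general locus), and which
contains the point `(τ'ⱼ)`: `U = mk⁻¹W ∖ ⋃_{i≠j} δ_{ij}(Cᵍ)` (the diagonal maps are proper, their images closed;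
★ `apply_eq_of_pt_mem_range_diagMap`, ★ `pt_mem_generalLocus_iff`, ★ `preimage_chartW`).  Milne JV Lemma 6.7 /
Thm. 5.1: the locus of `g` distinct points in general position. [cite: Milne1986JacobianVarieties, §5 Thm. 5.1 (a) and §6 Lemma 6.7] -/
theorem exists_stable_opens_injective (τ' : Fin g → AlgPoints C K) (hinj : Function.Injective τ')
    (hℓ : ell (tupleDiv C τ') = 1) :
    ∃ U : (powC C g).left.Opens,
      (∀ σ : Equiv.Perm (Fin g), permHom C.hom g σ ⁻¹ᵁ U = U) ∧
      (∀ (Ω : Type u) [Field Ω] [IsAlgClosed Ω] (τ : Spec (.of Ω) ⟶ powOver C.hom g),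
        (∀ t, τ t ∈ U) → Function.Injective fun i => τ ≫ powOver.proj C.hom g i) ∧
      U ≤ (symPowProj.mk C hC g).left ⁻¹ᵁ chartWOpens C g hC hX ∧
      AlgPoints.pt (tuplePt C (strPt (K := K) K) τ') ∈ U := by
  classical
  obtain ⟨δ, hδ⟩ : ∃ δ : Fin g × Fin g → (powC C g ⟶ powC C g),
      δ = fun p => liftOver C.hom g (fun l => coord C g (if l = p.2 then p.1 else l)) := ⟨_, rfl⟩
  -- the images of the diagonal maps are closed (properness)
  haveI hP : IsProper (powC C g).hom := isProper_powOver_base C.hom g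
  have hδc : ∀ p : Fin g × Fin g, IsClosed (Set.range (δ p).left) := fun p => by
    have h : IsProper ((δ p).left ≫ (powC C g).hom) := by rw [Over.w (δ p)]; infer_instance
    haveI : IsProper (δ p).left := IsProper.of_comp (δ p).left (powC C g).hom
    exact (δ p).left.isClosedMap.isClosed_range
  obtain ⟨D, hD⟩ : ∃ D : Set (powC C g).left,
      D = ⋃ p : {p : Fin g × Fin g // p.1 ≠ p.2}, Set.range (δ p.1).left := ⟨_, rfl⟩
  have hDc : IsClosed D := by rw [hD]; exact isClosed_iUnion_of_finite fun p => hδc p.1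
  -- `D` is `𝔖_g`-stable
  have hDσ : ∀ σ : Equiv.Perm (Fin g), permHom C.hom g σ '' D ⊆ D := by
    intro σ
    rintro _ ⟨z, hz, rfl⟩
    rw [hD] at hz ⊢
    obtain ⟨⟨⟨i, j⟩, hij⟩, w, rfl⟩ := Set.mem_iUnion.mp hz
    refine Set.mem_iUnion.mpr ⟨⟨(σ i, σ j), fun h => hij (σ.injective h)⟩, permHom C.hom g σ w, ?_⟩
    change ((δ (σ i, σ j)).left) ((permOver C.hom g σ).left w) = (permOver C.hom g σ).left ((δ (i, j)).left w)
    rw [← Scheme.Hom.comp_apply, ← Scheme.Hom.comp_apply, ← Over.comp_left, ← Over.comp_left, hδ,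
      diagMap_comp_permOver]
  have hDpre : ∀ σ : Equiv.Perm (Fin g), permHom C.hom g σ ⁻¹' D = D := by
    intro σ
    apply Set.Subset.antisymm
    · intro z hz
      have : z = permHom C.hom g σ⁻¹ (permHom C.hom g σ z) := by
        rw [← Scheme.Hom.comp_apply, ← permHom_mul, inv_mul_cancel, permHom_one]; rfl
      rw [this]
      exact hDσ σ⁻¹ ⟨_, hz, rfl⟩
    · intro z hz
      exact hDσ σ ⟨z, hz, rfl⟩
  -- the open
  set Wpre : (powC C g).left.Opens := (symPowProj.mk C hC g).left ⁻¹ᵁ chartWOpens C g hC hX with hWpre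
  refine ⟨Wpre ⊓ ⟨Dᶜ, hDc.isOpen_compl⟩, fun σ => ?_, fun Ω _ _ τ hτ => ?_, inf_le_left, ?_⟩
  · -- stability
    have hmk : ∀ z : (powC C g).left, (symPowProj.mk C hC g).left (permHom C.hom g σ z) =
        (symPowProj.mk C hC g).left z := fun z => by
      change (permOver C.hom g σ ≫ symPowProj.mk C hC g).left z = _
      rw [symPowProj.permOver_mk]
    ext z
    have h1 : permHom C.hom g σ z ∈ Wpre ↔ z ∈ Wpre := by
      change (symPowProj.mk C hC g).left (permHom C.hom g σ z) ∈ chartWOpens C g hC hX ↔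
        (symPowProj.mk C hC g).left z ∈ chartWOpens C g hC hX
      rw [hmk]
    have h2 : permHom C.hom g σ z ∈ D ↔ z ∈ D := Set.ext_iff.mp (hDpre σ) z
    change (permHom C.hom g σ z ∈ Wpre ∧ permHom C.hom g σ z ∉ D) ↔ (z ∈ Wpre ∧ z ∉ D)
    rw [h1, h2]
  · -- geometric points of `U` have distinct coordinates
    intro i j hij
    by_contra hne
    -- `τ` as a `K`-morphism from `Spec Ω` (over `K` via `τ ≫ (Cᵍ → Spec K)`)
    let τK : Over.mk (τ ≫ (powC C g).hom) ⟶ powC C g := Over.homMk τ rfl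
    have hij' : τK ≫ coord C g i = τK ≫ coord C g j := by
      ext : 1
      exact hij
    have hmem := mem_range_diagMap_of_comp_coord_eq C g τK hij' (IsLocalRing.closedPoint Ω)
    have hU := hτ (IsLocalRing.closedPoint Ω)
    apply hU.2
    rw [hD]
    exact Set.mem_iUnion.mpr ⟨⟨(i, j), hne⟩, by rw [hδ]; exact hmem⟩
  · -- the point `(τ'ⱼ)` lies in `U`
    refine ⟨?_, ?_⟩
    · change AlgPoints.pt (tuplePt C (strPt (K := K) K) τ') ∈ (symPowProj.mk C hC g).left ⁻¹' chartW C g hC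
      rw [preimage_chartW, pt_mem_generalLocus_iff C g]
      simpa only [tuplePt_coord] using hℓ
    · change AlgPoints.pt (tuplePt C (strPt (K := K) K) τ') ∉ D
      rw [hD]
      intro hmem
      obtain ⟨⟨⟨i, j⟩, hij⟩, hr⟩ := Set.mem_iUnion.mp hmem
      rw [hδ] at hr
      exact hij (hinj (apply_eq_of_pt_mem_range_diagMap C g τ' hr))

/-! ## §3 `f` is unramified near every point through which a good tuple passes -/

/-- **Weil's `f : C → J` is FORMALLY UNRAMIFIED on a neighbourhood of `τ'_{j₀}`** for every injective tuple
`τ'` of `K`-points with `ℓ(Σⱼ[τ'ⱼ]) = 1`: on `V = s_{τ'}⁻¹(U)` (§2), `t_c ∘ f = Σf ∘ s_{τ'}` (§1) factors as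
`V → U → W ↪ J` with `U → C^{(g)}` ÉTALE (★ `symPowGlued.etale_ι_comp_mk_of_stable`: the quotient `Cᵍ → C^{(g)}`
is étale off the big diagonal), `U → W` its lift into Weil's chart, `W ↪ J` the open immersion `f^{(g)}|_W`
(★ `isOpenImmersion_chartWOpens_ι_comp`), and `s_{τ'}` a closed immersion (a section of `pr_{j₀}`); translations
are isomorphisms. [cite: Milne1986JacobianVarieties, §2 Prop. 2.3 and §5 Thm. 5.1 (a)] -/
theorem exists_opens_formallyUnramified_fJ (τ' : Fin g → AlgPoints C K) (hinj : Function.Injective τ')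
    (hℓ : ell (tupleDiv C τ') = 1) :
    ∃ V : C.left.Opens, AlgPoints.pt (τ' j₀) ∈ V ∧ FormallyUnramified (V.ι ≫ (fJ C hC hX g hg hW j₀).left) := by
  classical
  haveI := hC.isSeparated
  obtain ⟨U, hUσ, hUinj, hUW, hUpt⟩ := exists_stable_opens_injective C hC hX g τ' hinj hℓ
  obtain ⟨S, hS⟩ := exists_symPowProj_desc_prod hC (Jac C hC hX g hg hW) (fJ C hC hX g hg hW j₀) g
  -- the tuple section and the open `V`
  obtain ⟨sτ, hsτ⟩ : ∃ sτ : C ⟶ powC C g,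
      sτ = liftOver C.hom g (fun j => if j = j₀ then 𝟙 C else const C C (τ' j)) := ⟨_, rfl⟩
  let V : C.left.Opens := sτ.left ⁻¹ᵁ U
  have hVpt : AlgPoints.pt (τ' j₀) ∈ V := by
    change sτ.left (AlgPoints.pt (τ' j₀)) ∈ U
    rw [← AlgPoints.pt_comp, hsτ, comp_liftOver_update, Function.update_eq_self]
    exact hUpt
  refine ⟨V, hVpt, ?_⟩
  -- (a) `s_{τ'}` is a closed immersion (a section of the separated `pr_{j₀}`), so `V → U` is unramified
  haveI : IsSeparated (powC C g).hom := isSeparated_powOver_base C.hom g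
  haveI : IsSeparated (coord C g j₀).left := by
    have : IsSeparated ((coord C g j₀).left ≫ C.hom) := by rw [Over.w (coord C g j₀)]; infer_instance
    exact IsSeparated.of_comp (coord C g j₀).left C.hom
  haveI : IsClosedImmersion sτ.left := by
    haveI : IsClosedImmersion (sτ.left ≫ (coord C g j₀).left) := by
      rw [← Over.comp_left, hsτ, liftOver_update_coord]
      exact inferInstanceAs (IsClosedImmersion (𝟙 C.left))
    exact IsClosedImmersion.of_comp sτ.left (coord C g j₀).left
  have hrange : Set.range (V.ι ≫ sτ.left) ⊆ Set.range U.ι := by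
    rintro _ ⟨v, rfl⟩
    rw [Scheme.Opens.range_ι]
    exact v.2
  let sV : (V : Scheme.{u}) ⟶ U := IsOpenImmersion.lift U.ι (V.ι ≫ sτ.left) hrange
  have hsV : sV ≫ U.ι = V.ι ≫ sτ.left := IsOpenImmersion.lift_fac _ _ _
  have hFU : ∀ {X₁ X₂ X₃ : Scheme.{u}} (a : X₁ ⟶ X₂) (b : X₂ ⟶ X₃), FormallyUnramified a → FormallyUnramified b →
      FormallyUnramified (a ≫ b) := fun a b ha hb => MorphismProperty.comp_mem _ a b ha hb
  haveI : FormallyUnramified sV := by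
    haveI : FormallyUnramified (sV ≫ U.ι) := by rw [hsV]; exact hFU _ _ inferInstance inferInstance
    exact FormallyUnramified.of_comp sV U.ι
  -- (b) `U → C^{(g)}` is étale (F1) and lands in `W`; its lift `U → W` is unramified
  haveI hEt : Etale (U.ι ≫ (symPowProj.mk C hC g).left) :=
    symPowGlued.etale_ι_comp_mk_of_stable C.hom g hC.finiteSubsetsInAffineOpens U hUσ hUinj
  have hrangeW : Set.range (U.ι ≫ (symPowProj.mk C hC g).left) ⊆ Set.range (chartWOpens C g hC hX).ι := by
    rintro _ ⟨z, rfl⟩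
    rw [Scheme.Opens.range_ι]
    exact hUW z.2
  let uW : (U : Scheme.{u}) ⟶ chartWOpens C g hC hX :=
    IsOpenImmersion.lift (chartWOpens C g hC hX).ι (U.ι ≫ (symPowProj.mk C hC g).left) hrangeW
  have huW : uW ≫ (chartWOpens C g hC hX).ι = U.ι ≫ (symPowProj.mk C hC g).left := IsOpenImmersion.lift_fac _ _ _
  haveI : FormallyUnramified uW := by
    haveI : FormallyUnramified (uW ≫ (chartWOpens C g hC hX).ι) := by rw [huW]; infer_instance
    exact FormallyUnramified.of_comp uW (chartWOpens C g hC hX).ι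
  -- (c) `W ↪ J` along `S = f^{(g)}` is an open immersion
  haveI := isOpenImmersion_chartWOpens_ι_comp C hC hX g hg hW j₀ S hS
  -- (d) assemble: `V.ι ≫ f ≫ t_c = sV ≫ uW ≫ (W.ι ≫ S)`
  have key := liftOver_comp_prod_coord_fJ C hC hX g hg hW j₀ τ'
  rw [← hsτ, ← hS] at key
  have hcomp : (V.ι ≫ (fJ C hC hX g hg hW j₀).left) ≫ ((Jac C hC hX g hg hW).translation
      (∏ j ∈ ({j₀}ᶜ : Finset (Fin g)), τ' j ≫ fJ C hC hX g hg hW j₀)).left =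
      sV ≫ uW ≫ ((chartWOpens C g hC hX).ι ≫ S.left) := by
    rw [Category.assoc, ← Over.comp_left, ← key, Over.comp_left, Over.comp_left, ← Category.assoc (V.ι),
      ← hsV, Category.assoc, ← Category.assoc U.ι, ← huW, Category.assoc]
  haveI hWS : FormallyUnramified ((chartWOpens C g hC hX).ι ≫ S.left) := inferInstance
  haveI : FormallyUnramified ((V.ι ≫ (fJ C hC hX g hg hW j₀).left) ≫ ((Jac C hC hX g hg hW).translation
      (∏ j ∈ ({j₀}ᶜ : Finset (Fin g)), τ' j ≫ fJ C hC hX g hg hW j₀)).left) := by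
    rw [hcomp]
    exact hFU _ _ inferInstance (hFU _ _ inferInstance hWS)
  exact FormallyUnramified.of_comp _ ((Jac C hC hX g hg hW).translation
      (∏ j ∈ ({j₀}ᶜ : Finset (Fin g)), τ' j ≫ fJ C hC hX g hg hW j₀)).left

end WeilJacobian

end Literature.AlgebraicGeometry.Motives

end
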